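import Summits.HubbardSuperconductivity.HubbardSuperconductivity.Theorems.FunctionFieldCertificateMesoscopicPairOrderInfraredWeight
import HarnessLib

/-!
# Crux `MesoscopicPairOrder` (stmt-HubbardSuperconductivity-7331): the Fejér-box pair functional is
# scale-antitone along multiples, `T_{kR}(ψ) ≤ k² T_R(ψ)`

Supports item `stmt-HubbardSuperconductivity-7331` of route `FunctionFieldCertificate` (line
`pointwise_split`, lead c7). The crux asks, at one `(U, δ)`, for a margin `m R² ≤ T_R(ψ)/L²` of the
Fejér-box `d`-wave pair functional `T_R(ψ) = Σ_{x,y} Πᵢ (1 - |(y - x)ᵢ|_L/R)₊ Re⟨P_x ψ, P_y ψ⟩` at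
ARBITRARILY LARGE scales `R`; its load-bearing stub (B) asks for the body at ONE scale. Here is the
elementary structural fact relating scales, for EVERY vector `ψ` (no ground-state input):

* `dirichletSum_add`, `norm_dirichletSum_mul_le` — `D_{R+R'}(u) = D_R(u) + e^{iRu} D_{R'}(u)`, hence
  `‖D_{kR}(u)‖ ≤ k ‖D_R(u)‖` (block decomposition of the Dirichlet sum; equivalently
  `|sin(kx)| ≤ k|sin x|`);
* `norm_boxKernel_mul_le` — the box kernel `F_R(m) = Σ_{u ∈ [0,R)^d} χ_m(u) = Πᵢ D_R(uᵢ)` obeys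
  `‖F_{kR}(m)‖ ≤ k^d ‖F_R(m)‖`, so the normalised Fejér weight `|F_R(m)|²/R^{2d}` is ANTITONE in `R`
  along multiples, at every momentum;
* `boxSum_mul_le_sq_mul_boxSum'` / `boxSum_mul_le_sq_mul_boxSum` (registered form) — by the momentum form `R² T_R(ψ) = Σ_m |F_R(m)|² S_ψ(m)`
  (`sq_mul_boxSum_eq_sum_boxKernel_mul_pairStructureFactor`, `S_ψ ≥ 0`): **`T_{kR}(ψ) ≤ k² T_R(ψ)`**
  for `0 < R`, `2kR ≤ L`; i.e. the block pair order per unit block area `T_R(ψ)/R²` is antitone along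
  the divisibility order of scales (`boxSum_div_sq_mul_le`);
* `margin_of_margin_mul` — consequently a margin `m (kR)² ≤ T_{kR}(ψ)/L²` at a scale passes DOWN to
  every divisor scale with the SAME `m`: `m R² ≤ T_R(ψ)/L²`. In particular the crux body at `(U, δ)`
  tested along any divisibility chain `R₁ ∣ R₂ ∣ ⋯` has a non-increasing optimal margin, the seed (B) at
  scale `R₀` follows from the body at any multiple of `R₀` with no loss, and a uniform margin at
  arbitrarily large scales is the `R → ∞` END of a monotone quantity along each chain — the whole content
  of the crux is that this limit is positive (cf. `mesoscopicPairOrder_iff_infraredPairWeight`, which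
  passes between ALL scales at the price of the constant `16/π⁴`).

Nothing here proves or refutes the crux. Sources: E. M. Stein, R. Shakarchi, *Fourier Analysis* (2003),
Ch. 2 §5 (Dirichlet/Fejér kernels); A. Zygmund, *Trigonometric Series* I (2002), Ch. II §6;
T. Kennedy, E. H. Lieb, B. S. Shastry, PRL 61 (1988) 2582 (Fourier bookkeeping of order operators).
Folklore statements; no definition, no named fact.
-/

noncomputable section

-- the summit namespace repeats the problem name by design (D-0017)
set_option linter.dupNamespace false

namespace Summit.HubbardSuperconductivity.HubbardSuperconductivity.Theorems.FunctionFieldCertificate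

open Matrix Finset Filter Complex
open Literature.Probability.LatticeModels Literature.MathematicalPhysics.QuantumLattice
open Summit.HubbardSuperconductivity.HubbardSuperconductivity.Theses.FunctionFieldCertificate
open scoped ComplexOrder ComplexConjugate

/-! ### Dirichlet sums over multiples of a block -/

/-- **Block decomposition of the Dirichlet sum**: `D_{R+R'}(u) = D_R(u) + e^{iRu} D_{R'}(u)`.
Stein–Shakarchi, *Fourier Analysis*, Ch. 2 §5. [folklore] -/
theorem dirichletSum_add (R R' : ℕ) (u : ℝ) :
    dirichletSum (R + R') u =
      dirichletSum R u + Complex.exp ((R : ℝ) * u * I) * dirichletSum R' u := by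
  unfold dirichletSum
  rw [Finset.sum_range_add, Finset.mul_sum]
  congr 1
  refine Finset.sum_congr rfl fun n _ => ?_
  rw [← Complex.exp_add]
  congr 1
  push_cast
  ring

/-- `‖e^{ixu}‖ = 1` for real `x, u` (phase factor of the block decomposition). [folklore] -/
theorem norm_exp_natCast_mul_mul_I (R : ℕ) (u : ℝ) : ‖Complex.exp ((R : ℝ) * u * I)‖ = 1 := by
  rw [show ((R : ℝ) : ℂ) * (u : ℂ) * I = (((R : ℝ) * u : ℝ) : ℂ) * I by push_cast; ring,
    Complex.norm_exp_ofReal_mul_I]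

/-- **`‖D_{kR}(u)‖ ≤ k ‖D_R(u)‖`** (sum of `k` phase-shifted copies of `D_R`; equivalently
`|sin(kx)| ≤ k |sin x|`). Zygmund, *Trigonometric Series* I, Ch. II §6. [folklore] -/
theorem norm_dirichletSum_mul_le (k R : ℕ) (u : ℝ) :
    ‖dirichletSum (k * R) u‖ ≤ (k : ℝ) * ‖dirichletSum R u‖ := by
  induction k with
  | zero => simp [dirichletSum]
  | succ k ih =>
    rw [Nat.succ_mul, dirichletSum_add]
    calc ‖dirichletSum (k * R) u + Complex.exp (((k * R : ℕ) : ℝ) * u * I) * dirichletSum R u‖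
        ≤ ‖dirichletSum (k * R) u‖ + ‖Complex.exp (((k * R : ℕ) : ℝ) * u * I) * dirichletSum R u‖ :=
          norm_add_le _ _
      _ = ‖dirichletSum (k * R) u‖ + ‖dirichletSum R u‖ := by
          rw [norm_mul, norm_exp_natCast_mul_mul_I, one_mul]
      _ ≤ (k : ℝ) * ‖dirichletSum R u‖ + ‖dirichletSum R u‖ := by gcongr
      _ = ((k + 1 : ℕ) : ℝ) * ‖dirichletSum R u‖ := by push_cast; ring

/-! ### The box kernel along multiples -/

variable {L : ℕ} [NeZero L]

/-- **`‖F_{kR}(m)‖ ≤ k^d ‖F_R(m)‖`** for the box kernel `F_R(m) = Σ_{u ∈ [0,R)^d} χ_m(u) = Πᵢ D_R(uᵢ)`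
(`boxKernel_eq_prod_dirichletSum`): the normalised Fejér weight `|F_R(m)|²/R^{2d}` is antitone in `R`
along multiples, at every momentum `m`. [folklore] -/
theorem norm_boxKernel_mul_le {d : ℕ} (m : TorusSite d L) (k R : ℕ) :
    ‖∑ u : Fin d → Fin (k * R), torusChar m (fun i => ((u i : ℕ) : ZMod L))‖ ≤
      (k : ℝ) ^ d * ‖∑ u : Fin d → Fin R, torusChar m (fun i => ((u i : ℕ) : ZMod L))‖ := by
  rw [boxKernel_eq_prod_dirichletSum, boxKernel_eq_prod_dirichletSum, norm_prod, norm_prod]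
  calc ∏ i, ‖dirichletSum (k * R) (2 * Real.pi * (((m i).valMinAbs : ℤ) : ℝ) / L)‖
      ≤ ∏ i, ((k : ℝ) * ‖dirichletSum R (2 * Real.pi * (((m i).valMinAbs : ℤ) : ℝ) / L)‖) :=
        Finset.prod_le_prod (fun i _ => norm_nonneg _) fun i _ => norm_dirichletSum_mul_le k R _
    _ = (k : ℝ) ^ d * ∏ i, ‖dirichletSum R (2 * Real.pi * (((m i).valMinAbs : ℤ) : ℝ) / L)‖ := by
        rw [Finset.prod_mul_distrib, Finset.prod_const, Finset.card_univ, Fintype.card_fin]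

/-! ### `T_{kR}(ψ) ≤ k² T_R(ψ)` -/

/-- **The Fejér-box pair functional is scale-antitone along multiples**: for every vector `ψ`,
`0 < R`, `0 < k` and `2kR ≤ L`, `T_{kR}(ψ) ≤ k² T_R(ψ)` (at `k = 0` Lean's `x/0 = 0` makes
`T_0 = ‖Σ_x P_x ψ‖²`, so `0 < k` is needed) — from `(kR)² T_{kR} = Σ_m |F_{kR}(m)|² S_ψ(m)`,
`|F_{kR}|² ≤ k⁴ |F_R|²` and `S_ψ ≥ 0`. Kennedy–Lieb–Shastry (1988) bookkeeping; Stein–Shakarchi Ch. 2.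
[folklore] -/
theorem boxSum_mul_le_sq_mul_boxSum' (R k : ℕ) (hR : 0 < R) (hk : 0 < k) (hkRL : 2 * (k * R) ≤ L)
    (ψ : Fock (Orb (FermionTorus 2 L))) :
    (∑ x : TorusSite 2 L, ∑ y : TorusSite 2 L,
        (∏ i : Fin 2, max 0 (1 - |(((y i - x i).valMinAbs : ℤ) : ℝ)| / ((k * R : ℕ) : ℝ))) *
          (star (localPair dWaveFormFactor L x *ᵥ ψ) ⬝ᵥ (localPair dWaveFormFactor L y *ᵥ ψ)).re) ≤
      (k : ℝ) ^ 2 * (∑ x : TorusSite 2 L, ∑ y : TorusSite 2 L,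
        (∏ i : Fin 2, max 0 (1 - |(((y i - x i).valMinAbs : ℤ) : ℝ)| / (R : ℝ))) *
          (star (localPair dWaveFormFactor L x *ᵥ ψ) ⬝ᵥ (localPair dWaveFormFactor L y *ᵥ ψ)).re) := by
  have hkR : 0 < k * R := Nat.mul_pos hk hR
  have hRL : 2 * R ≤ L := le_trans (by nlinarith) hkRL
  have hidk := sq_mul_boxSum_eq_sum_boxKernel_mul_pairStructureFactor (L := L) (k * R) hkR hkRL ψ
  have hidR := sq_mul_boxSum_eq_sum_boxKernel_mul_pairStructureFactor (L := L) R hR hRL ψ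
  have hSnn : ∀ m : TorusSite 2 L, 0 ≤ pairStructureFactor dWaveFormFactor L ψ m :=
    fun m => pairStructureFactor_nonneg _ _ _ _
  -- `Σ_m |F_{kR}|² S ≤ k⁴ Σ_m |F_R|² S`
  have hsum : ∑ m : TorusSite 2 L,
        ‖∑ u : Fin 2 → Fin (k * R), torusChar m (fun i => ((u i : ℕ) : ZMod L))‖ ^ 2 *
          pairStructureFactor dWaveFormFactor L ψ m ≤
      (k : ℝ) ^ 4 * ∑ m : TorusSite 2 L,
        ‖∑ u : Fin 2 → Fin R, torusChar m (fun i => ((u i : ℕ) : ZMod L))‖ ^ 2 *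
          pairStructureFactor dWaveFormFactor L ψ m := by
    rw [Finset.mul_sum]
    refine Finset.sum_le_sum fun m _ => ?_
    have h := norm_boxKernel_mul_le (L := L) m k R
    have h2 : ‖∑ u : Fin 2 → Fin (k * R), torusChar m (fun i => ((u i : ℕ) : ZMod L))‖ ^ 2 ≤
        ((k : ℝ) ^ 2 * ‖∑ u : Fin 2 → Fin R, torusChar m (fun i => ((u i : ℕ) : ZMod L))‖) ^ 2 :=
      pow_le_pow_left₀ (norm_nonneg _) h 2
    calc _ ≤ ((k : ℝ) ^ 2 * ‖∑ u : Fin 2 → Fin R, torusChar m (fun i => ((u i : ℕ) : ZMod L))‖) ^ 2 *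
          pairStructureFactor dWaveFormFactor L ψ m := mul_le_mul_of_nonneg_right h2 (hSnn m)
      _ = _ := by ring
  rw [← hidk, ← hidR] at hsum
  -- `(kR)² T_{kR} ≤ k⁴ R² T_R`; divide by `(kR)² > 0`
  have hkR2 : (0 : ℝ) < ((k * R : ℕ) : ℝ) ^ 2 := by positivity
  have hsum' : ((k * R : ℕ) : ℝ) ^ 2 * (∑ x : TorusSite 2 L, ∑ y : TorusSite 2 L,
        (∏ i : Fin 2, max 0 (1 - |(((y i - x i).valMinAbs : ℤ) : ℝ)| / ((k * R : ℕ) : ℝ))) *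
          (star (localPair dWaveFormFactor L x *ᵥ ψ) ⬝ᵥ (localPair dWaveFormFactor L y *ᵥ ψ)).re) ≤
      ((k * R : ℕ) : ℝ) ^ 2 * ((k : ℝ) ^ 2 * (∑ x : TorusSite 2 L, ∑ y : TorusSite 2 L,
        (∏ i : Fin 2, max 0 (1 - |(((y i - x i).valMinAbs : ℤ) : ℝ)| / (R : ℝ))) *
          (star (localPair dWaveFormFactor L x *ᵥ ψ) ⬝ᵥ (localPair dWaveFormFactor L y *ᵥ ψ)).re)) := by
    calc _ ≤ _ := hsum
      _ = _ := by push_cast; ring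
  exact le_of_mul_le_mul_left hsum' hkR2

/-- **Block pair order per unit block area is antitone along multiples**: `T_{kR}(ψ)/(kR)² ≤ T_R(ψ)/R²`
for `0 < R`, `0 < k`, `2kR ≤ L`. [folklore] -/
theorem boxSum_div_sq_mul_le (R k : ℕ) (hR : 0 < R) (hk : 0 < k) (hkRL : 2 * (k * R) ≤ L)
    (ψ : Fock (Orb (FermionTorus 2 L))) :
    (∑ x : TorusSite 2 L, ∑ y : TorusSite 2 L,
        (∏ i : Fin 2, max 0 (1 - |(((y i - x i).valMinAbs : ℤ) : ℝ)| / ((k * R : ℕ) : ℝ))) *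
          (star (localPair dWaveFormFactor L x *ᵥ ψ) ⬝ᵥ (localPair dWaveFormFactor L y *ᵥ ψ)).re) /
        ((k * R : ℕ) : ℝ) ^ 2 ≤
      (∑ x : TorusSite 2 L, ∑ y : TorusSite 2 L,
        (∏ i : Fin 2, max 0 (1 - |(((y i - x i).valMinAbs : ℤ) : ℝ)| / (R : ℝ))) *
          (star (localPair dWaveFormFactor L x *ᵥ ψ) ⬝ᵥ (localPair dWaveFormFactor L y *ᵥ ψ)).re) /
        (R : ℝ) ^ 2 := by
  have h := boxSum_mul_le_sq_mul_boxSum' R k hR hk hkRL ψ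
  have hRpos : (0 : ℝ) < R := Nat.cast_pos.2 hR
  have hkpos : (0 : ℝ) < k := Nat.cast_pos.2 hk
  rw [div_le_div_iff₀ (by positivity) (by positivity)]
  calc _ ≤ (k : ℝ) ^ 2 * (∑ x : TorusSite 2 L, ∑ y : TorusSite 2 L,
        (∏ i : Fin 2, max 0 (1 - |(((y i - x i).valMinAbs : ℤ) : ℝ)| / (R : ℝ))) *
          (star (localPair dWaveFormFactor L x *ᵥ ψ) ⬝ᵥ (localPair dWaveFormFactor L y *ᵥ ψ)).re) *
        (R : ℝ) ^ 2 := mul_le_mul_of_nonneg_right h (by positivity)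
    _ = _ := by push_cast; ring

/-- **A margin passes down to divisor scales with no loss**: `m (kR)² ≤ T_{kR}(ψ)/L² ⇒ m R² ≤ T_R(ψ)/L²`
(`0 < R`, `0 < k`, `2kR ≤ L`). So along any divisibility chain of scales the optimal margin of the crux
body is non-increasing, the one-scale seed (B) at `R₀` follows from the body at any multiple of `R₀`,
and the crux's uniform margin "at arbitrarily large scales" is the `R → ∞` end of a monotone quantity
on each chain. [folklore] -/
theorem margin_of_margin_mul (R k : ℕ) (hR : 0 < R) (hk : 0 < k) (hkRL : 2 * (k * R) ≤ L)
    (ψ : Fock (Orb (FermionTorus 2 L))) {m : ℝ}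
    (h : m * ((k * R : ℕ) : ℝ) ^ 2 ≤ (∑ x : TorusSite 2 L, ∑ y : TorusSite 2 L,
        (∏ i : Fin 2, max 0 (1 - |(((y i - x i).valMinAbs : ℤ) : ℝ)| / ((k * R : ℕ) : ℝ))) *
          (star (localPair dWaveFormFactor L x *ᵥ ψ) ⬝ᵥ (localPair dWaveFormFactor L y *ᵥ ψ)).re) /
        (L : ℝ) ^ 2) :
    m * (R : ℝ) ^ 2 ≤ (∑ x : TorusSite 2 L, ∑ y : TorusSite 2 L,
        (∏ i : Fin 2, max 0 (1 - |(((y i - x i).valMinAbs : ℤ) : ℝ)| / (R : ℝ))) *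
          (star (localPair dWaveFormFactor L x *ᵥ ψ) ⬝ᵥ (localPair dWaveFormFactor L y *ᵥ ψ)).re) /
        (L : ℝ) ^ 2 := by
  have hmono := boxSum_mul_le_sq_mul_boxSum' R k hR hk hkRL ψ
  have hLpos : (0 : ℝ) < L := Nat.cast_pos.2 (Nat.pos_of_ne_zero (NeZero.ne L))
  have hL2 : (0 : ℝ) < (L : ℝ) ^ 2 := by positivity
  have hkpos : (0 : ℝ) < k := Nat.cast_pos.2 hk
  have hk2 : (0 : ℝ) < (k : ℝ) ^ 2 := by positivity
  rw [le_div_iff₀ hL2] at h ⊢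
  -- `m (kR)² L² ≤ T_{kR} ≤ k² T_R`, so `k² (m R² L²) ≤ k² T_R`
  have h' : (k : ℝ) ^ 2 * (m * (R : ℝ) ^ 2 * (L : ℝ) ^ 2) ≤ (k : ℝ) ^ 2 *
      (∑ x : TorusSite 2 L, ∑ y : TorusSite 2 L,
        (∏ i : Fin 2, max 0 (1 - |(((y i - x i).valMinAbs : ℤ) : ℝ)| / (R : ℝ))) *
          (star (localPair dWaveFormFactor L x *ᵥ ψ) ⬝ᵥ (localPair dWaveFormFactor L y *ᵥ ψ)).re) := by
    calc _ = m * ((k * R : ℕ) : ℝ) ^ 2 * (L : ℝ) ^ 2 := by push_cast; ring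
      _ ≤ _ := h
      _ ≤ _ := hmono
  exact le_of_mul_le_mul_left h' hk2

/-- **`T_{kR}(ψ) ≤ k² T_R(ψ)`, registered form** (sub-goal `boxSum_mul_le_sq_mul_boxSum` of item
stmt-HubbardSuperconductivity-7331, quantifiers explicit). [folklore] -/
theorem boxSum_mul_le_sq_mul_boxSum : ∀ {L : ℕ} [NeZero L] (R k : ℕ), 0 < R → 0 < k → 2 * (k * R) ≤ L → ∀ ψ : Fock (Orb (FermionTorus 2 L)), (∑ x : TorusSite 2 L, ∑ y : TorusSite 2 L, (∏ i : Fin 2, max 0 (1 - |(((y i - x i).valMinAbs : ℤ) : ℝ)| / ((k * R : ℕ) : ℝ))) * (star (localPair dWaveFormFactor L x *ᵥ ψ) ⬝ᵥ (localPair dWaveFormFactor L y *ᵥ ψ)).re) ≤ (k : ℝ) ^ 2 * (∑ x : TorusSite 2 L, ∑ y : TorusSite 2 L, (∏ i : Fin 2, max 0 (1 - |(((y i - x i).valMinAbs : ℤ) : ℝ)| / (R : ℝ))) * (star (localPair dWaveFormFactor L x *ᵥ ψ) ⬝ᵥ (localPair dWaveFormFactor L y *ᵥ ψ)).re) := by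
  intro L _ R k hR hk hkRL ψ
  exact boxSum_mul_le_sq_mul_boxSum' R k hR hk hkRL ψ

end Summit.HubbardSuperconductivity.HubbardSuperconductivity.Theorems.FunctionFieldCertificate
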